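import Summits.QuantumFields.YangMills.Theorems.BalabanUVNodesK0AxCauchyDecouplingBlocks

/-!
# K0⁷/K0ᴬ cover, FE cluster half — Cauchy–decoupling helper §5: THE DECOUPLING EXPANSION IN FINITE-SET FORM
# (`F(s[S ↦ 1]) = Σ_{Q ⊆ S} (Δ_Q F)(s[S ↦ 0])`) AND ITS TERMWISE CAUCHY RATE

LANDING NOTE (porter ▶ PTC-1 g4, 2026-08-31; AUTHORSHIP = ◇ lens-1 g12 «cauchy-analytic», HOME sketch `nodeO-cover/LENS-1g12-CauchyDecouplingSetExpansion-v1.lean` sha16 418f51c7431474bf · 103 l. ·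
7 thm · no def · 0 sorry (CANDIDATE 15: the SET-FORM EXPANSION — ✓`decoupling_expansion` re-indexed by the POWERSET (`decoupling_expansion_finset`) and, with the model factorisation entered as a
DISPLAYED hypothesis `hfac`, the blocks edition `decoupling_expansion_finset_blocks` = literally the left side of ✓`PolymerGasGeometric.sum_powerset_prod_rcomponents`; companion of ✓p824330 ∕
✓p824499 ∕ ✓p824868 ∕ ✓p825291)): landed VERBATIM (only this paragraph added) under the basename ◇ proposed (`…Theorems/BalabanUVNodesK0AxCauchyDecouplingSetExpansion.lean`, same ns
`…Theorems.K0AxCauchyDecoupling`) as INTENT-76; one import ✓p825291 `…K0AxCauchyDecouplingBlocks`; `--supports stmt-QuantumFields-27930 --as helper` (NO `--workitem`; kind proof); ◆ CRIT-1 g38's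
cut: «(c) CUT CANDIDATE 15 → GO VERBATIM; 7 thm ∕ 0 def; axioms standard on 4 guarded names; J4 7 × 0; J1′∕J5′: pure re-indexation» (nodeO STATUS 2026-08-31T14:21:16Z).  HONEST (porter):
re-indexation bookkeeping, kernel-checked — no estimate, no model object; proves NOTHING of Bałaban (the only non-tree inputs of the N3 → polymer-gas route remain the two model letters N8b
(`hfac`) and N4-R (the activity bound), both OPEN); ⟨27930⟩ `stub_FE` ∕ `stub_P0C` OPEN; K0ᴬ stmt-QuantumFields-27238 OPEN; NODE O 0∕1; COUNT 8∕28 · K 1∕4 UNMOVED; finite 𝕋⁴ at fixed ε — NOT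
continuum ∕ OS ∕ Clay; the Yang–Mills mass gap is NOT proved by any of this.

Lens-1 (ideator 1, g12) NODE v13.3 «cauchy-analytic», step (a) of the corrected FE-2 chain (HOME
`nodeO-cover/LENS-1-NODE-v13p3.md`).  MODEL-FREE bookkeeping: the list-indexed identity ✓`decoupling_expansion`
(✓p824330, sum over `List.sublists'`) re-indexed by the POWERSET of a finite set of parameters, with the set-form
differences ✓`decDiffSet` of ✓`BalabanUVNodesK0AxCauchyDecouplingBlocks` — the indexation in which the polymer layer of the
tree is written (✓`Literature.Probability.LatticeModels.PolymerGasGeometric.sum_powerset_prod_rcomponents` sums over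
`Finset.powerset`).  With ✓`decDiffSet_biUnion_id_prod` (blocks = `rcomponents` of `Q`) the `Q`-term factorises into
connected-polymer activities once the MODEL letter N8b supplies the factorisation of the normalised fluctuation factor;
✓`sum_powerset_prod_rcomponents` then yields `polymerPartitionFunction`, and the Kotecký–Preiss layer
(✓`ClusterExpansion.exp_polymerLogZ`, ✓`polymerLogZ_eq_sum_truncatedWeight`) takes the logarithm (print [II] (2.11)–(2.13)).

HONEST FRAMING.  Finite-set re-indexation of a landed identity; NOTHING of [Balaban1988RG2Cluster] is asserted, ported or
discharged (cited as LOCATOR of the structure only); no model object of the record occurs; `stub_FE` ∕ `stub_P0C` of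
⟨stmt-QuantumFields-27930⟩, K0⁷ ⟨20541⟩, K0ᴬ ⟨27238⟩ stay OPEN and nothing here proves any part of them; NODE O 0∕1; finite 𝕋⁴ at
fixed ε — NOT continuum ∕ OS; **the Yang–Mills mass gap (Clay) is NOT proved by any of this.**  No `sorry`, no `instance`, no
`notation`, no `def`; standard axioms.
-/

noncomputable section

open Function

namespace Summit.QuantumFields.YangMills.Theorems.K0AxCauchyDecoupling

variable {ι : Type*} [DecidableEq ι]

/-- Re-indexation (bookkeeping): for a duplicate-free list `l`, summing `g (Z.toFinset)` over the sublists `Z` of `l` is summing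
`g` over the powerset of `l.toFinset`. -/
theorem sum_map_sublists'_toFinset (g : Finset ι → ℂ) :
    ∀ (l : List ι), l.Nodup → ((l.sublists').map fun Z => g Z.toFinset).sum = ∑ Q ∈ l.toFinset.powerset, g Q
  | [], _ => by simp
  | y :: l, hnd => by
      obtain ⟨hyl, hl⟩ := List.nodup_cons.mp hnd
      have hy : y ∉ l.toFinset := fun h => hyl (List.mem_toFinset.mp h)
      rw [List.sublists'_cons, List.map_append, List.sum_append, List.map_map, List.toFinset_cons,
        Finset.sum_powerset_insert hy, sum_map_sublists'_toFinset g l hl]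
      congr 1
      have h2 := sum_map_sublists'_toFinset (fun Q => g (insert y Q)) l hl
      simpa [Function.comp_def, List.toFinset_cons] using h2

/-- On a sublist `Z` of a duplicate-free `l`, the list difference is the set difference of `Z.toFinset` (bookkeeping). -/
theorem decDiffList_eq_decDiffSet_of_mem_sublists' {l Z : List ι} (hl : l.Nodup) (hZ : Z ∈ l.sublists')
    (G : (ι → ℂ) → ℂ) : decDiffList Z G = decDiffSet Z.toFinset G :=
  (decDiffSet_eq_decDiffList ((List.mem_sublists'.mp hZ).nodup hl) rfl G).symm

/-- `setOn` through a finite set's enumeration depends only on membership in the set (bookkeeping). -/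
theorem setOn_toList_apply (S : Finset ι) (c : ℂ) (s : ι → ℂ) (i : ι) :
    setOn S.toList c s i = if i ∈ S then c else s i := by
  simp [setOn, Finset.mem_toList]

/-- ★★★ **THE DECOUPLING EXPANSION, FINITE-SET FORM**: for a finite set `S` of parameters,
`F(s[S ↦ 1]) = Σ_{Q ⊆ S} (Δ_Q F)(s[S ↦ 0])` — the fully coupled value is the sum over the decoupled subsets `Q` of the powerset of
the set-differences at zero coupling on `S`.  (✓`decoupling_expansion` re-indexed by ✓`sum_map_sublists'_toFinset`.)
[cite: Balaban1988RG2Cluster, (1.9)–(1.10) p.4–5 and (2.8)–(2.9) p.13 (the expansion over localization sets Y ⊆ Z; locator); Dimock2013, §4.5 p.19–20 (locator)] -/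
theorem decoupling_expansion_finset (F : (ι → ℂ) → ℂ) (S : Finset ι) (s : ι → ℂ) :
    F (setOn S.toList 1 s) = ∑ Q ∈ S.powerset, decDiffSet Q F (setOn S.toList 0 s) := by
  rw [decoupling_expansion F S.toList (Finset.nodup_toList S) s]
  have h : ((S.toList.sublists').map fun Z => decDiffList Z F (setOn S.toList 0 s))
      = (S.toList.sublists').map fun Z => decDiffSet Z.toFinset F (setOn S.toList 0 s) :=
    List.map_congr_left fun Z hZ => by rw [decDiffList_eq_decDiffSet_of_mem_sublists' (Finset.nodup_toList S) hZ]
  rw [h, sum_map_sublists'_toFinset (fun Q => decDiffSet Q F (setOn S.toList 0 s)) S.toList (Finset.nodup_toList S),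
    Finset.toList_toFinset]

/-- ★★ **TERMWISE CAUCHY RATE, finite-set form**: every `Q`-term of `decoupling_expansion_finset` is bounded by `M ∕ (R − 1)^{#Q}`
for `F` separately holomorphic and bounded by `M` on the closed polydisc of radius `R > 1`. [cite: Balaban1987RG1, (1.18) p.263 (shape); Balaban1988RG2Cluster, (1.24) p.7 (locator)] -/
theorem norm_decoupling_term_finset_le {R M : ℝ} (hR : 1 < R) {F : (ι → ℂ) → ℂ}
    (hhol : SepHolOff R [] F) (hbdd : BddOnPoly R M F) (S Q : Finset ι) {s : ι → ℂ} (hs : s ∈ cpoly R) :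
    ‖decDiffSet Q F (setOn S.toList 0 s)‖ ≤ M / (R - 1) ^ Q.card :=
  norm_decDiffSet_le hR hhol hbdd Q (setOn_mem_cpoly S.toList (by simp; linarith) hs)

/-- The same in the (1.18) currency: `‖(Δ_Q F)(s[S ↦ 0])‖ ≤ M·e^{−κ₁ #Q}` once `e^{κ₁} ≤ R − 1`. -/
theorem norm_decoupling_term_finset_le_exp {R M κ₁ : ℝ} (hR : 1 < R) (hκ : Real.exp κ₁ ≤ R - 1) (hM : 0 ≤ M)
    {F : (ι → ℂ) → ℂ} (hhol : SepHolOff R [] F) (hbdd : BddOnPoly R M F) (S Q : Finset ι) {s : ι → ℂ}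
    (hs : s ∈ cpoly R) : ‖decDiffSet Q F (setOn S.toList 0 s)‖ ≤ M * Real.exp (-κ₁ * Q.card) :=
  norm_decDiffSet_le_exp hR hκ hM hhol hbdd Q (setOn_mem_cpoly S.toList (by simp; linarith) hs)

/-- ★★ **EXPANSION × BLOCKS**: if on the powerset of `S` the functional's `Q`-difference is computed from a product of block-local
factors over a pairwise disjoint family `𝒳 Q` of blocks covering `Q` (the MODEL's factorisation over the components of `Q`, letter
N8b, entered as the DISPLAYED hypothesis `hfac`), then
`F(s[S ↦ 1]) = Σ_{Q ⊆ S} Π_{X ∈ 𝒳 Q} (Δ_X (G Q X))(s[S ↦ 0])` — the shape consumed by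
✓`PolymerGasGeometric.sum_powerset_prod_rcomponents` (with `𝒳 Q = rcomponents R Q`). [cite: Balaban1988RG2Cluster, (2.10)–(2.11) p.14] -/
theorem decoupling_expansion_finset_blocks (F : (ι → ℂ) → ℂ) (S : Finset ι) (s : ι → ℂ)
    (𝒳 : Finset ι → Finset (Finset ι)) (G : Finset ι → Finset ι → (ι → ℂ) → ℂ)
    (hcov : ∀ Q ∈ S.powerset, (𝒳 Q).biUnion id = Q)
    (hdisj : ∀ Q ∈ S.powerset, ∀ X ∈ 𝒳 Q, ∀ X' ∈ 𝒳 Q, X ≠ X' → Disjoint X X')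
    (hloc : ∀ Q ∈ S.powerset, ∀ X ∈ 𝒳 Q, ∀ y, y ∉ X → IndepOf y (G Q X))
    (hfac : ∀ Q ∈ S.powerset,
      decDiffSet Q F (setOn S.toList 0 s) = decDiffSet Q (fun φ => ∏ X ∈ 𝒳 Q, G Q X φ) (setOn S.toList 0 s)) :
    F (setOn S.toList 1 s) = ∑ Q ∈ S.powerset, ∏ X ∈ 𝒳 Q, decDiffSet X (G Q X) (setOn S.toList 0 s) := by
  rw [decoupling_expansion_finset F S s]
  refine Finset.sum_congr rfl fun Q hQ => ?_
  have hb := decDiffSet_biUnion_id_prod (𝒳 Q) (G Q) (hdisj Q hQ) (hloc Q hQ)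
  rw [hcov Q hQ] at hb
  rw [hfac Q hQ, hb]

end Summit.QuantumFields.YangMills.Theorems.K0AxCauchyDecoupling

end
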